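import Summits.FinalStateConjecture.FinalStateConjecture.Theses.StarvedNecks
import Literature.Geometry.Lorentzian.ShellDeviation
import Literature.Geometry.Lorentzian.CoordCurvature
import Literature.Geometry.Lorentzian.CoordScalarCurvatureEvolution
import HarnessLib.Audit

/-!
# Line `order-zero-induction-zone` (generation 2) — crux `NecksCertify` (stmt-FinalStateConjecture-13549)

Skeleton (generation 2) of the line "necks are induction zones: the growing-radius `C²` certificate
of a hole chart is an ORDER-ZERO two-point elliptic problem on the neck annulus, pinned inside by
the fixed-radius certificate and outside by the flat chart's `C⁰` clause; orders one and two
follow from scale-invariant boundedness at radii `≥ R_g(τ) → ∞`", route `StarvedNecks` of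
`FinalStateConjecture`; idea card `Cruxes/NecksCertify/Ideas/order-zero-induction-zone.md`,
triage `TRIAGE-r1-1.md` (pass; sharpenings (a)–(d)), line card `Lines/order-zero-induction-zone.md`.

## Why a second generation

Generation 1 (same path, git history) cut the crux into `annulusPinning / certificateAssembly /
inductionZoneGauge / seamSurgery` and put the WHOLE analytic content — gauge construction, the
radiative (transient) budget and the quasi-static closure — into the single XL existence stub
`stub_inductionZoneGauge`, whose structure FIELDS were the analytic conclusions. That is how the
line reads, but not how it can be PROVED: the a-priori `C⁰` control a two-point elliptic closure
needs in its own gauge is not free (strong short-scale radiation on the neck is consistent with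
the input's `C⁰` Voronoi bound `Hf` (3) until the radiative budget excludes it), so construction,
budget and closure are coupled through a BOOTSTRAP. Generation 2 types the bootstrap: the
coupling itself becomes a stub (`stub_gaugeConstruction`, a continuity argument) and the two
halves of the analysis become CONDITIONAL A-PRIORI ESTIMATES on a typed bootstrap object
(`NeckGauge S T` over a PDE-free `NeckShape S`, horizon `T ∈ (τ₁, ∞]`), each a precise statement
a different specialist can attack: `stub_transientDecay` (hyperbolic / radiative — the
barrier-bitten half, shared with line `bargmann-small-late-exterior`) and `stub_quasiStaticDecay`
(elliptic — the card's lever applied). Registered signatures are the verbatim statements.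

## The line in one paragraph

On the neck `{R_g(τ) ≤ r'ᵢ ≤ W(τ)}` of hole `i` the Kerr–Schild tail is `O(M/r') → 0`, so
"certified to boosted Kerr" means "certified to flat", in UNWEIGHTED `C²`. Choose per hole a new
rest frame (boost = physical velocity, rotation = axis alignment: no `O(1)` twist between the two
ends), slow radii `R_g → ∞` (so the inherited certificate is SCALE-INVARIANTLY small out to `8R_g`)
and `W = o(τ)`, and the SLICE-HARMONIC REST GAUGE on `(2R_g, 16W)`: maximal rest slices spanning
the two anchor spheres (Bartnik's Plateau problem) and harmonic spatial rest coordinates, with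
DIRICHLET matching to the old hole chart at `r' = 2R_g` and to the (drift-translated) old flat
chart at `r' = 16W` — one uniform condition `Δ̸ x'^μ = 0` (`sliceLap`). In this gauge the vacuum
equations are a quasi-static elliptic system (lapse `ΔN = N|K|²`, shift `Δβ + Ric β = 2K∂N`,
slice metric `γ^{kl}∂ₖ∂ₗγ = −2N⁻¹∂ₜK + …`); its PAST-WINDOW time average at window `κW` (below
the first Dirichlet eigenfrequency, `W = o(τ)`) is pinned AT ORDER ZERO from both ends and has
shell-summable forcing once the TRANSIENT remainder (radiation in transit) is small in `C⁰`,
scale-invariant `C¹`, unweighted `C²` and shell-square-summable — so the two-point pinning lemma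
on `E3` annuli (`stub_annulusPinning`) and interior regularity at scale `r'` give scale-invariant
`C²` smallness of the quasi-static part (`stub_quasiStaticDecay`), while the transient remainder is
the radiative budget (`stub_transientDecay`: outgoing content slaved to the certificate at emission
— its scale-invariant `C¹` size is `R₀ ×` the unweighted size at `r = R₀` — incoming content the
route's incoming budget). Both are stated under the bootstrap assumption `Boot δ₀` (`C⁰` and
scale-invariant `C¹` ≤ δ₀, unweighted `C²` ≤ δ₀: the true regularity profile of a far neck —
scale-invariant `C²` of radiation in transit GROWS like `r'`), uniformly in the horizon `T`; the
gauge exists globally with `Boot δ₀` for every `δ₀ > 0` by continuity (`stub_gaugeConstruction`;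
slice-wise elliptic, no accumulation). Blending the anchors and the gauge chart with cutoffs gives
certified final charts and the seam raw material (`stub_chartSurgery`), and the seam surgery
(`stub_seamSurgery`, generation 1's, shared with the route's own line) returns the `C²`
decomposition `d₂` with `Hc ∧ Sm`. `NecksCertify_of` composes the six (kernel-checked).

## Disproof / negatives honoured

No `Disproof.lean` exists for this crux (payload path absent on the hub; `ledger crux ls` lists
Ideas, Lines, TRIAGE only — 2026-08-16), so no `_false_without_` theorem and no landed
`Theorems/NecksCertify/Negative/` lemma could be imported or cited. Standing evidence honoured:
refuter-rattack-13549-0 (refuted-MISSTATED: `Sm` (12) needs pairwise distinct asymptotic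
velocities) enters through `NeckShape.necks_far` (satisfiable exactly under the planner's pending
`DistinctVelocities` repair, like the crux itself); TRIAGE §A (log-loss on long annuli) is built
into `stub_annulusPinning` (`∫ s g(s) ds`, not `sup r²|f|`) and into `TransientBound`
(shell-square-summability); TRIAGE (b) (rectification) is why the transient sector is a separate,
scale-invariant, shell-summable stub; TRIAGE (c) (`Hf` (3) load-bearing) is why the a-priori bound
is a BOOTSTRAP assumption and not a frame field; TRIAGE (d) (seam shared) is `stub_seamSurgery`.
Negatives index: 0 refuted statements for the summit (2026-08-16).
-/

noncomputable section

set_option linter.dupNamespace false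

open Literature.Geometry.Lorentzian
open scoped Manifold ContDiff ENNReal Topology NNReal
open Filter Set TopologicalSpace MeasureTheory

namespace Summit.FinalStateConjecture.FinalStateConjecture.Cruxes.NecksCertify.OrderZeroInductionZone

/-! ### The three let-bundles of `NecksCertify`, verbatim, as definitions -/

/-- `Hc` of `NecksCertify` (HonestCore), verbatim. -/
def InCore (𝓢 : Spacetime.{0} 4) (O : Set 𝓢.carrier) (k : ℕ) (d : FinalStateDecomposition 𝓢 O k)
    (R₀ : ℝ) : Prop :=
  let B := d.background; let t := fun i ↦ (B i).time; let r := fun i ↦ (B i).radius; let Ψ := d.chart; (∀ i, Kerr.IsSubextremal (d.mass i) (d.spin i) ∧ 100 * d.mass i ≤ R₀ ∧ 0 < ((d.motion i).1 : E4 ≃L[ℝ] E4) (E4.basisVector 0) 0) ∧ (∀ i (ϱ τ₂ : ℝ), R₀ ≤ ϱ → d.τ₀ < τ₂ → Ψ i '' {x | d.τ₀ < t i x.1 ∧ t i x.1 < τ₂ ∧ r i x.1 < ϱ} ⊆ 𝓢.metric.causalPast 𝓢.timeOrientation (Ψ i '' (B i).truncTimeSlab ϱ τ₂)) ∧ (∀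 i (τ' : ℝ) (ϱ : ℝ → ℝ), Continuous ϱ → d.τ₀ < τ' → let A := Ψ i '' {x | τ' ≤ t i x.1 ∧ r i x.1 ≤ ϱ (t i x.1)}; closure A ∩ O ⊆ A) ∧ (∀ y : d.flatDomain, d.τ₀ < y.1 0 → 𝓢.timeOrientation.IsFutureDirected (mfderiv 𝓘(ℝ, E4) (𝓡 4) d.flatChart y (E4.basisVector 0)))
/-- `Hf` of `NecksCertify` (HonestFar), verbatim. -/
def InFar (𝓢 : Spacetime.{0} 4) (O : Set 𝓢.carrier) (k : ℕ) (d : FinalStateDecomposition 𝓢 O k)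
    (R₀ : ℝ) : Prop :=
  let B := d.background; let t := fun i ↦ (B i).time; let r := fun i ↦ (B i).radius; let Φ := d.flatChart; (∀ τ₂ : ℝ, d.τ₀ < τ₂ → Φ '' {y | d.τ₀ < y.1 0 ∧ y.1 0 < τ₂} ⊆ 𝓢.metric.causalPast 𝓢.timeOrientation (Φ '' (Minkowski.backgroundOn d.flatDomain).timeSlab τ₂)) ∧ (∀ τ' : ℝ, d.τ₀ < τ' → closure (Φ '' {y | τ' ≤ y.1 0 ∧ ∀ i, d.excision i (y.1 0) + 1 ≤ r i y.1}) ⊆ Φ '' {y | τ' ≤ y.1 0}) ∧ (∀ i, ∃ T : ℝ, supCkENorm (Subtype.val '' {x : (B i).domain | T ≤ t i x.1 ∧ R₀ ≤ r i x.1 ∧ ∀ j, j ≠ i → r i x.1 ≤ r j x.1}) 0 (𝓢.deviationExtend (B i) (d.chart i)) ≤ ENNReal.ofReal (1 / (10 * ‖(((d.motion i).1 : E4 ≃L[ℝ] E4) : E4 →L[ℝ] E4)‖ ^ 2)))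
/-- `Sm` of `NecksCertify` (SEAMED), verbatim. -/
def Seamed (𝓢 : Spacetime.{0} 4) (O : Set 𝓢.carrier) (d : FinalStateDecomposition 𝓢 O 2)
    (R : Fin d.N → ℝ → ℝ) (R₀ : ℝ) : Prop :=
  let B := d.background; let t := fun i ↦ (B i).time; let r := fun i ↦ (B i).radius; let Λ := fun i ↦ ((d.motion i).1 : E4 ≃L[ℝ] E4); let Φ := d.flatChart; let Ψ := d.chart; let ρ := d.excision; (∀ i, Monotone (R i) ∧ Continuous (R i) ∧ ∀ s, R₀ + 4 ≤ R i s ∧ R₀ ≤ ρ i s) ∧ (∀ i, Tendsto (fun τ ↦ 𝓢.truncDeviationCk (B i) (Ψ i) 2 (R i τ) τ) atTop (𝓝 0)) ∧ supCkENorm (Subtype.val '' {y : d.flatDomain | d.τ₀ ≤ y.1 0}) 0 (𝓢.deviationExtend (Minkowski.backgroundOn d.flatDomain) Φ) ≤ 10⁻¹ ∧ (∀ i, supCkENorm (Subtype.val '' {x : (B i).domain | (d.τ₀ ≤ t i x.1 ∨ d.τ₀ ≤ x.1 0) ∧ R₀ ≤ r i x.1 ∧ r i x.1 ≤ R i (t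 i x.1)}) 0 (𝓢.deviationExtend (B i) (Ψ i)) ≤ ENNReal.ofReal (1 / (10 * ‖(Λ i : E4 →L[ℝ] E4)‖ ^ 2))) ∧ (∀ i (x : (B i).domain), (d.τ₀ ≤ t i x.1 ∨ d.τ₀ ≤ x.1 0) → R₀ ≤ r i x.1 → r i x.1 ≤ R i (t i x.1) → 𝓢.timeOrientation.IsFutureDirected (mfderiv 𝓘(ℝ, E4) (𝓡 4) (Ψ i) x ((Λ i) (E4.basisVector 0)))) ∧ (∀ i (y : E4) (hy : y ∈ (B i).domain), d.τ₀ ≤ y 0 → (∀ j, ρ j (y 0) < r j y) → r i y ≤ R i (t i y) + 1 → ∃ hy' : y ∈ d.flatDomain, Ψ i ⟨y, hy⟩ = Φ ⟨y, hy'⟩) ∧ (∀ y : d.flatDomain, d.τ₀ ≤ y.1 0 → ∀ j, ρ j (y.1 0) < r j y.1) ∧ (∀ j (y : E4), d.τ₀ ≤ y 0 → r j y ≤ ρ j (y 0) → r j y + 2 ≤ R j (t j y)) ∧ (∀ j (y : E4), d.τ₀ ≤ t j y → r j y ≤ R j (t j y) + 2 → t j y ≤ y 0) ∧ (∀ j,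 Ψ j '' {x | d.τ₀ < t j x.1 ∧ R j (t j x.1) + 1 < r j x.1} ⊆ d.radiationZone) ∧ (∀ τ' : ℝ, d.τ₀ < τ' → closure (Φ '' {y | τ' ≤ y.1 0}) ⊆ Φ '' {y | τ' ≤ y.1 0} ∪ ⋃ j, Ψ j '' {x | τ' ≤ x.1 0 ∧ r j x.1 = ρ j (x.1 0)}) ∧ (∀ j j' (y : E4), j ≠ j' → (d.τ₀ ≤ y 0 ∨ d.τ₀ ≤ t j y) → r j y ≤ R j (t j y) + 1 → R j' (t j' y) + 1 < r j' y)
/-- `NecksCertify` unfolded through the three bundles (definitional). -/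
theorem necksCertify_iff :
    _root_.Summit.FinalStateConjecture.FinalStateConjecture.Theses.StarvedNecks.NecksCertify ↔
      ∀ (X : Type) [TopologicalSpace X] [ChartedSpace E3 X] [IsManifold (𝓡 3) ∞ X]
        [ConnectedSpace X] (D : InitialDataSet (𝓡 3) X), D ∈ admissibleVacuumData X →
        ∀ 𝒟 : VacuumCauchyDevelopment D, 𝒟.IsMaximal →
        ∀ (O : Set 𝒟.carrier) (d : FinalStateDecomposition 𝒟.toSpacetime O 4) (R₀ : ℝ),
          O = exteriorOf 𝒟.toCauchyDevelopment d.charted →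
          InCore 𝒟.toSpacetime O 4 d R₀ → InFar 𝒟.toSpacetime O 4 d R₀ →
          ∃ (d₂ : FinalStateDecomposition 𝒟.toSpacetime O 2) (R : Fin d₂.N → ℝ → ℝ) (R₀' : ℝ),
            O = exteriorOf 𝒟.toCauchyDevelopment d₂.charted ∧ InCore 𝒟.toSpacetime O 2 d₂ R₀' ∧
              Seamed 𝒟.toSpacetime O d₂ R R₀' :=
  Iff.rfl

/-! ### Rest frames and rest coordinates of a motion `m = (Λ, c)` -/

/-- The boosted Kerr reference background of a motion `m = (Λ, c)` and parameters `(M, a)`. -/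
abbrev bg (m : lorentzGroup × E4) (M a : ℝ) : ModelBackground :=
  boostedKerrBackground m.1 m.2 M a

/-- Rest coordinate `x'^μ(x) = (Λ⁻¹(x − c))^μ` of the motion `m` (an affine function on `E4`). -/
def restCoord (m : lorentzGroup × E4) (μ : Fin 4) (x : E4) : ℝ := poincareInv m.1 m.2 x μ

/-- Rest-frame Kerr–Schild time `t'(x) = (Λ⁻¹(x − c))⁰`. -/
def restTime (m : lorentzGroup × E4) (x : E4) : ℝ := poincareInv m.1 m.2 x 0

/-- Rest-frame Kerr–Schild radius `r'(x) = r_a(Λ⁻¹(x − c))`. -/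
def restRadius (m : lorentzGroup × E4) (a : ℝ) (x : E4) : ℝ := Kerr.radius a (poincareInv m.1 m.2 x)

/-- The rest-frame time axis `Λ e₀`. -/
def timeAxis (m : lorentzGroup × E4) : E4 := (m.1 : E4 ≃L[ℝ] E4) (E4.basisVector 0)

/-- The (constant) differential `dt'` of the rest time: `v ↦ (Λ⁻¹ v)⁰`. -/
def restTimeCovector (m : lorentzGroup × E4) : E4 →L[ℝ] ℝ :=
  (EuclideanSpace.proj (0 : Fin 4) : E4 →L[ℝ] ℝ).comp ((m.1 : E4 ≃L[ℝ] E4).symm : E4 →L[ℝ] E4)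

/-- Passage from NEW rest-frame coordinates (motion `mNew`) through a self-map `E` of the rest
frame to the OLD motion's ambient point: `y ↦ Λ_old (E (Λ_new⁻¹(y − c_new))) + c_old`. -/
def liftToOld (mNew mOld : lorentzGroup × E4) (E : E4 → E4) (y : E4) : E4 :=
  (mOld.1 : E4 ≃L[ℝ] E4) (E (poincareInv mNew.1 mNew.2 y)) + mOld.2

/-! ### Coordinate metric, slice-harmonic gauge, past-window quasi-static / transient split -/

variable (𝓢 : Spacetime.{0} 4)

/-- The pulled-back metric COMPONENTS `G = g_{Kerr,m} + (Ψ^*g − g_{Kerr,m})` of a map `Ψ` on the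
boosted Kerr exterior of the motion `m`, as a field of bilinear forms on `E4` (junk off the
domain): the datum of the coordinate tensor calculus `MetricCoord.*`. -/
def coordMetric (m : lorentzGroup × E4) (M a : ℝ) (Ψ : boostedKerrExterior m.1 m.2 M a → 𝓢.carrier)
    (x : E4) : E4 →L[ℝ] E4 →L[ℝ] ℝ :=
  (bg m M a).bilin x + 𝓢.deviationExtend (bg m M a) Ψ x

/-- **Slice Laplacian** of a function `f` for the components `G` and the rest time `t'` of the
motion `m`: `Δ̸ f := □_G f + Hess_G f (♯dt', ♯dt') / (−G⁻¹(dt', dt'))`, i.e. the trace of the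
`G`-Hessian of `f` over the `G`-orthogonal complement of `∇t'` (Gauss: `= Δ_Σ(f|_Σ) + H·n(f)` on
the level sets `Σ` of `t'`). The SLICE-HARMONIC REST GAUGE is `Δ̸ x'^μ = 0`, `μ = 0, …, 3`:
`μ = 0` says the rest slices are MAXIMAL, `μ = 1, 2, 3` that the spatial rest coordinates are
harmonic for the induced metric (Andersson–Moncrief spatial-harmonic gauge; Bartnik maximal
slices) — an elliptic, slice-wise gauge with two Dirichlet ends. -/
def sliceLap (G : E4 → E4 →L[ℝ] E4 →L[ℝ] ℝ) (m : lorentzGroup × E4) (f : E4 → ℝ) (x : E4) : ℝ :=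
  MetricCoord.lapAt G f x +
    MetricCoord.hessAt G f x (MetricCoord.sharpAt G x (restTimeCovector m))
        (MetricCoord.sharpAt G x (restTimeCovector m)) /
      (-(restTimeCovector m (MetricCoord.sharpAt G x (restTimeCovector m))))

/-- A fixed smooth bump on `ℝ` centred at `−3/2` with radii `1/4 < 1/2`: support in `[−2, −1]`.
Normalised, it is the kernel of the PAST-WINDOW time average (no window point lies in the future
of the evaluation point, and integration by parts in time produces no boundary terms). -/
def pastBump : ContDiffBump (-(3 / 2 : ℝ)) := ⟨1 / 4, 1 / 2, by norm_num, by norm_num⟩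

/-- **Quasi-static part** of the deviation `Ψ^*g − g_{Kerr,m}`: its rest-frame time average over
the PAST window `t' ∈ [t'(x) − 2κW, t'(x) − κW]` (`W = W(t'(x))`), i.e. the content of rest
time-frequency `≲ 1/(κW)` — below the first Dirichlet eigenfrequency of the neck annulus. -/
def qsField (m : lorentzGroup × E4) (M a : ℝ) (Ψ : boostedKerrExterior m.1 m.2 M a → 𝓢.carrier)
    (W : ℝ → ℝ) (κ : ℝ) (x : E4) : E4 →L[ℝ] E4 →L[ℝ] ℝ :=
  ∫ s, pastBump.normed volume s •
    𝓢.deviationExtend (bg m M a) Ψ (x + (κ * W (restTime m x) * s) • timeAxis m)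

/-- **Transient part**: deviation minus its quasi-static part (radiation in transit, all content of
rest time-scale `≲ κW`, and the `O(κW/τ)` lag drift of the quasi-static content). -/
def trField (m : lorentzGroup × E4) (M a : ℝ) (Ψ : boostedKerrExterior m.1 m.2 M a → 𝓢.carrier)
    (W : ℝ → ℝ) (κ : ℝ) (x : E4) : E4 →L[ℝ] E4 →L[ℝ] ℝ :=
  𝓢.deviationExtend (bg m M a) Ψ x - qsField 𝓢 m M a Ψ W κ x


/-! ### The neck SHAPE: a constructor's PDE-free choices (radii, rest frames, the two anchors) -/

/-- **Neck shape** for the honest `C⁴` input `d` (threshold radius `R₀`) — HYPOTHESIS STRUCTURE.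
The PDE-free raw material of the neck gauge of every hole `i`: a late time `τ₁`; a NEW rest frame
`motion i = (Λ'ᵢ, c'ᵢ)` (free: its boost part is the hole's physical velocity in the flat chart,
its rotation part ALIGNS the flat chart's spatial frame at the outer anchor with the Kerr axis —
this is what removes any `O(1)` twist between the two Dirichlet ends); smooth, monotone, slowly
varying radii `Rg → ∞` (diagonal radius, chosen SLOWLY: the old fixed-radius certificate is then
small in SCALE-INVARIANT `C³` out to `8Rg`, field `in_cert`) and `W` (sublinear, `64 Rg ≤ W`,
`W' → 0`); the averaging parameter `κ ≥ 1`; the INNER ANCHOR `inChart i` = the old hole chart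
re-coordinatised to the new rest frame through a smooth slab/radius-preserving `reparam i`
(time shift + axial rotations; `in_eq`), with its scale-invariant certificate; the OUTER ANCHOR =
the old flat chart translated by the hole's slow drift `drift i` (`|drift| ≤ W/4`, derivatives
`→ 0`), defined on the outer zone `{W ≤ r' ≤ 256 W}` (`outer_dom`); necks of different holes far
apart (`necks_far`) and old flat tubes small against new radii (`old_excision_lt`). Inhabiting it
(together with a gauge, below) is `stub_gaugeConstruction`. -/
structure NeckShape (𝓢 : Spacetime.{0} 4) (O : Set 𝓢.carrier)
    (d : FinalStateDecomposition 𝓢 O 4) (R₀ : ℝ) where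
  /-- The late rest time from which every clause holds. -/
  τ₁ : ℝ
  τ₀_le_τ₁ : d.τ₀ ≤ τ₁
  /-- New rest frames (orthochronous). -/
  motion : Fin d.N → lorentzGroup × E4
  orthochronous : ∀ i, 0 < timeAxis (motion i) 0
  /-- Radii and averaging parameter. -/
  Rg : Fin d.N → ℝ → ℝ
  W : Fin d.N → ℝ → ℝ
  κ : Fin d.N → ℝ
  one_le_κ : ∀ i, 1 ≤ κ i
  contDiff_Rg : ∀ i, ContDiff ℝ ∞ (Rg i)
  contDiff_W : ∀ i, ContDiff ℝ ∞ (W i)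
  monotone_Rg : ∀ i, Monotone (Rg i)
  monotone_W : ∀ i, Monotone (W i)
  one_le_Rg : ∀ i τ, 1 ≤ Rg i τ
  R₀_le_Rg : ∀ i τ, R₀ ≤ Rg i τ
  four_mass_le_Rg : ∀ i τ, 4 * d.mass i ≤ Rg i τ
  tendsto_Rg : ∀ i, Tendsto (Rg i) atTop atTop
  Rg_le_W : ∀ i τ, 64 * Rg i τ ≤ W i τ
  tendsto_deriv_Rg : ∀ i, Tendsto (deriv (Rg i)) atTop (𝓝 0)
  tendsto_deriv_W : ∀ i, Tendsto (deriv (W i)) atTop (𝓝 0)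
  tendsto_W_div : ∀ i, Tendsto (fun t ↦ W i t / t) atTop (𝓝 0)
  /-- INNER ANCHOR: the old hole chart, re-coordinatised (`liftToOld`) through `reparam i`. -/
  reparam : Fin d.N → E4 → E4
  /-- Clock correction `t ↦ t + shift(t)` (slowly varying, increasing: synchronises the old hole
  clock with the flat clock at the outer anchor). -/
  shift : Fin d.N → ℝ → ℝ
  reparam_bijective : ∀ i, Function.Bijective (reparam i)
  reparam_contDiff : ∀ i, ContDiff ℝ ∞ (reparam i)
  contDiff_shift : ∀ i, ContDiff ℝ ∞ (shift i)
  strictMono_shift : ∀ i, StrictMono (fun t ↦ t + shift i t)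
  reparam_time : ∀ i z, reparam i z 0 = z 0 + shift i (z 0)
  τ₀_le_shift : ∀ i t, τ₁ ≤ t → d.τ₀ ≤ t + shift i t
  reparam_radius : ∀ i z, Kerr.radius (d.spin i) (reparam i z) = Kerr.radius (d.spin i) z
  inChart : ∀ i, boostedKerrExterior (motion i).1 (motion i).2 (d.mass i) (d.spin i) → 𝓢.carrier
  in_isLateChart : ∀ i, 𝓢.IsLateChart (bg (motion i) (d.mass i) (d.spin i)) O τ₁ (inChart i)
  in_eq : ∀ i (y : E4) (hy : y ∈ boostedKerrExterior (motion i).1 (motion i).2 (d.mass i) (d.spin i)),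
    τ₁ ≤ restTime (motion i) y →
    ∃ hy' : liftToOld (motion i) (d.motion i) (reparam i) y ∈
        boostedKerrExterior (d.motion i).1 (d.motion i).2 (d.mass i) (d.spin i),
      inChart i ⟨y, hy⟩ = d.chart i ⟨liftToOld (motion i) (d.motion i) (reparam i) y, hy'⟩
  /-- The inherited certificate, SCALE-INVARIANT in `C³` at scale `Rg(τ)` out to `8 Rg(τ)`
  (free from the input by choosing `Rg` slowly — the diagonal argument). -/
  in_cert : ∀ i, Tendsto (fun τ ↦ scaleCkENorm
      (Subtype.val '' (bg (motion i) (d.mass i) (d.spin i)).truncTimeSlab (8 * Rg i τ) τ) 3 (Rg i τ)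
      (𝓢.deviationExtend (bg (motion i) (d.mass i) (d.spin i)) (inChart i))) atTop (𝓝 0)
  /-- OUTER ANCHOR: the old flat chart translated by the slow spatial drift of the hole. -/
  drift : Fin d.N → ℝ → E4
  drift_time : ∀ i t, drift i t 0 = 0
  contDiff_drift : ∀ i, ContDiff ℝ ∞ (drift i)
  tendsto_iteratedDeriv_drift : ∀ i (m : ℕ), 1 ≤ m → m ≤ 3 →
    Tendsto (fun t ↦ iteratedDeriv m (drift i) t) atTop (𝓝 0)
  drift_small : ∀ i (y : E4), τ₁ ≤ restTime (motion i) y →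
    restRadius (motion i) (d.spin i) y ≤ 256 * W i (restTime (motion i) y) →
    4 * ‖drift i (y 0)‖ ≤ W i (restTime (motion i) y)
  outer_dom : ∀ i (y : E4), τ₁ ≤ restTime (motion i) y →
    W i (restTime (motion i) y) ≤ restRadius (motion i) (d.spin i) y →
    restRadius (motion i) (d.spin i) y ≤ 256 * W i (restTime (motion i) y) →
    d.τ₀ < y 0 ∧ y + drift i (y 0) ∈ (d.flatDomain : Set E4)
  /-- Old flat tubes are small against the new radii: at flat-late points beyond `8 W_j` of hole
  `j`, any spatial translate by at most half the rest radius stays outside the old tube `j`. -/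
  old_excision_lt : ∀ j (y v : E4), τ₁ ≤ y 0 →
    8 * W j (restTime (motion j) y) ≤ restRadius (motion j) (d.spin j) y → v 0 = 0 →
    2 * ‖v‖ ≤ restRadius (motion j) (d.spin j) y →
    d.excision j (y 0) < Kerr.radius (d.spin j) (poincareInv (d.motion j).1 (d.motion j).2 (y + v))
  /-- Necks of different holes are far apart (needs pairwise distinct asymptotic velocities — the
  crux's own `DistinctVelocities` caveat, refuter-rattack-13549). -/
  necks_far : ∀ i j (y : E4), i ≠ j → τ₁ ≤ restTime (motion i) y →
    restRadius (motion i) (d.spin i) y ≤ 256 * W i (restTime (motion i) y) →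
    256 * W j (restTime (motion j) y) < restRadius (motion j) (d.spin j) y ∧
      1024 * W i (restTime (motion i) y) < restRadius (motion j) (d.spin j) y

namespace NeckShape

variable {𝓢 : Spacetime.{0} 4} {O : Set 𝓢.carrier} {d : FinalStateDecomposition 𝓢 O 4} {R₀ : ℝ}

/-- Rest time of hole `i` in the shape's frame. -/
abbrev rt (S : NeckShape 𝓢 O d R₀) (i : Fin d.N) (x : E4) : ℝ := restTime (S.motion i) x

/-- Rest radius of hole `i` in the shape's frame. -/
abbrev rr (S : NeckShape 𝓢 O d R₀) (i : Fin d.N) (x : E4) : ℝ :=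
  restRadius (S.motion i) (d.spin i) x

/-- The reference background of hole `i` in the shape's frame. -/
abbrev B (S : NeckShape 𝓢 O d R₀) (i : Fin d.N) : ModelBackground :=
  bg (S.motion i) (d.mass i) (d.spin i)

/-- Times in the half-open horizon `[τ₁, T)` (`T = ⊤`: all late times). -/
def InTime (S : NeckShape 𝓢 O d R₀) (T : WithTop ℝ) (i : Fin d.N) (x : E4) : Prop :=
  S.τ₁ ≤ S.rt i x ∧ ((S.rt i x : ℝ) : WithTop ℝ) < T

/-- LAGGED times: `t' ∈ [τ₁ + 2κW(t'), T)` AND `W` at most doubles over the past averaging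
window `[t' − 2κW(t'), t' − κW(t')]` (eventually true since `W' → 0`). Then the window lies in
`[τ₁, t']` and a window point over the interior neck `{4Rg(t') ≤ r' ≤ 8W(t')}` stays inside the
closed gauge region of its own (earlier) time, so only controlled values enter the quasi-static /
transient split; conclusions are asked at lagged times only. -/
def Lagged (S : NeckShape 𝓢 O d R₀) (T : WithTop ℝ) (i : Fin d.N) (x : E4) : Prop :=
  S.τ₁ + 2 * S.κ i * S.W i (S.rt i x) ≤ S.rt i x ∧ ((S.rt i x : ℝ) : WithTop ℝ) < T ∧
    S.W i (S.rt i x) ≤ 2 * S.W i (S.rt i x - 2 * S.κ i * S.W i (S.rt i x))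

end NeckShape

/-! ### The neck GAUGE on a time horizon `T` (bootstrap object) -/

/-- **Neck gauge** over the shape `S` on the time horizon `T ∈ (τ₁, ∞]` — HYPOTHESIS STRUCTURE
(the object of the continuity argument; `T = ⊤` is the global gauge). Per hole: the GAUGE CHART
`chart i` (auxiliary; it becomes the new hole chart only on `{4Rg ≤ r' ≤ 8W}` after the chart
surgery) and the two TRANSITION MAPS `Ein i`, `Eout i : E4 → E4` with
`chart = inChart ∘ Ein` on `{r' ≤ 8Rg}`, `chart = flatChart_old ∘ (+drift) ∘ Eout` on
`{W ≤ r' ≤ 256W}`, DIRICHLET matching `Ein = id` on `{r' ≤ 2Rg}`, `Eout = id` on `{r' ≥ 16W}`;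
on the open gauge region `{2Rg < r' < 16W}` (times in `[τ₁, T)`) the rest coordinate functions
are SLICE-HARMONIC for the pulled-back metric (maximal rest slices, harmonic spatial rest
coordinates: `sliceLap G x'^μ = 0`), and the pulled-back components are a smooth nondegenerate
RICCI-FLAT field (`ricciFlat`: true for any chart of the vacuum development, recorded so that the
analytic stubs are PDE statements on `E4`). No smallness inside. -/
structure NeckGauge {𝓢 : Spacetime.{0} 4} {O : Set 𝓢.carrier} {d : FinalStateDecomposition 𝓢 O 4}
    {R₀ : ℝ} (S : NeckShape 𝓢 O d R₀) (T : WithTop ℝ) where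
  /-- The gauge chart of hole `i` (on its whole boosted Kerr exterior domain; only the gauge
  region matters). -/
  chart : ∀ i, boostedKerrExterior (S.motion i).1 (S.motion i).2 (d.mass i) (d.spin i) → 𝓢.carrier
  /-- Transition maps to the two anchors. -/
  Ein : Fin d.N → E4 → E4
  Eout : Fin d.N → E4 → E4
  continuous_Ein : ∀ i, Continuous (Ein i)
  continuous_Eout : ∀ i, Continuous (Eout i)
  Ein_eq : ∀ i (y : E4), S.rr i y ≤ 2 * S.Rg i (S.rt i y) → Ein i y = y
  Eout_eq : ∀ i (y : E4), 16 * S.W i (S.rt i y) ≤ S.rr i y → Eout i y = y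
  contDiffOn_Ein : ∀ i, ContDiffOn ℝ ∞ (Ein i)
    {y | S.τ₁ < S.rt i y ∧ ((S.rt i y : ℝ) : WithTop ℝ) < T ∧ 2 * S.Rg i (S.rt i y) < S.rr i y ∧
      S.rr i y < 16 * S.Rg i (S.rt i y)}
  contDiffOn_Eout : ∀ i, ContDiffOn ℝ ∞ (Eout i)
    {y | S.τ₁ < S.rt i y ∧ ((S.rt i y : ℝ) : WithTop ℝ) < T ∧ S.W i (S.rt i y) < S.rr i y ∧
      S.rr i y < 16 * S.W i (S.rt i y)}
  chart_in : ∀ i (y : E4) (hy : y ∈ boostedKerrExterior (S.motion i).1 (S.motion i).2 (d.mass i) (d.spin i)),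
    S.InTime T i y → S.rr i y ≤ 8 * S.Rg i (S.rt i y) →
    ∃ hy' : Ein i y ∈ boostedKerrExterior (S.motion i).1 (S.motion i).2 (d.mass i) (d.spin i),
      chart i ⟨y, hy⟩ = S.inChart i ⟨Ein i y, hy'⟩
  chart_out : ∀ i (y : E4) (hy : y ∈ boostedKerrExterior (S.motion i).1 (S.motion i).2 (d.mass i) (d.spin i)),
    S.InTime T i y → S.W i (S.rt i y) ≤ S.rr i y → S.rr i y ≤ 256 * S.W i (S.rt i y) →
    ∃ hz : Eout i y + S.drift i (Eout i y 0) ∈ (d.flatDomain : Set E4),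
      chart i ⟨y, hy⟩ = d.flatChart ⟨Eout i y + S.drift i (Eout i y 0), hz⟩
  /-- Regularity on an open neighbourhood `V i` of the OPEN GAUGE REGION
  `{τ₁ ≤ t' < T, 2Rg < r' < 16W}` (across the two Dirichlet spheres the gauge chart is only
  continuous; there the anchors carry the regularity): smooth nondegenerate components, smooth
  open embedding into `O`. -/
  V : Fin d.N → Set E4
  isOpen_V : ∀ i, IsOpen (V i)
  region_subset_V : ∀ i, {y | S.InTime T i y ∧ 2 * S.Rg i (S.rt i y) < S.rr i y ∧
    S.rr i y < 16 * S.W i (S.rt i y)} ⊆ V i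
  V_subset : ∀ i, V i ⊆ (boostedKerrExterior (S.motion i).1 (S.motion i).2 (d.mass i) (d.spin i) : Set E4)
  isMetricOn : ∀ i,
    MetricCoord.IsMetricOn (coordMetric 𝓢 (S.motion i) (d.mass i) (d.spin i) (chart i)) (V i)
  contMDiffOn_chart : ∀ i, ContMDiffOn 𝓘(ℝ, E4) (𝓡 4) ∞ (chart i) (Subtype.val ⁻¹' V i)
  isOpenEmbedding_chart : ∀ i, Topology.IsOpenEmbedding ((Subtype.val ⁻¹' V i).restrict (chart i))
  image_subset : ∀ i, chart i '' (Subtype.val ⁻¹' V i) ⊆ O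
  /-- VACUUM in coordinates: the components are Ricci-flat on `V i`. -/
  ricciFlat : ∀ i, ∀ x ∈ V i,
    MetricCoord.ricAt (coordMetric 𝓢 (S.motion i) (d.mass i) (d.spin i) (chart i)) x = 0
  /-- GAUGE: slice-harmonic rest coordinates on the open gauge region `{2Rg < r' < 16W}`. -/
  sliceHarmonic : ∀ i (x : E4), S.InTime T i x → 2 * S.Rg i (S.rt i x) < S.rr i x →
    S.rr i x < 16 * S.W i (S.rt i x) → ∀ μ : Fin 4,
    sliceLap (coordMetric 𝓢 (S.motion i) (d.mass i) (d.spin i) (chart i)) (S.motion i)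
      (restCoord (S.motion i) μ) x = 0

namespace NeckGauge

variable {𝓢 : Spacetime.{0} 4} {O : Set 𝓢.carrier} {d : FinalStateDecomposition 𝓢 O 4} {R₀ : ℝ}
  {S : NeckShape 𝓢 O d R₀} {T : WithTop ℝ}

/-- The deviation `chart^* g − g_{Kerr,motion i}` of the gauge chart of hole `i`, on `E4`. -/
abbrev dev (𝒢 : NeckGauge S T) (i : Fin d.N) : E4 → E4 →L[ℝ] E4 →L[ℝ] ℝ :=
  𝓢.deviationExtend (S.B i) (𝒢.chart i)

/-- Its quasi-static part (past-window rest-time average at window `κᵢ Wᵢ`). -/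
abbrev qs (𝒢 : NeckGauge S T) (i : Fin d.N) : E4 → E4 →L[ℝ] E4 →L[ℝ] ℝ :=
  qsField 𝓢 (S.motion i) (d.mass i) (d.spin i) (𝒢.chart i) (S.W i) (S.κ i)

/-- Its transient part. -/
abbrev tr (𝒢 : NeckGauge S T) (i : Fin d.N) : E4 → E4 →L[ℝ] E4 →L[ℝ] ℝ :=
  trField 𝓢 (S.motion i) (d.mass i) (d.spin i) (𝒢.chart i) (S.W i) (S.κ i)

/-- **BOOTSTRAP ASSUMPTION `Boot δ`**: on the open gauge region (times in `[τ₁, T)`,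
`2Rg < r' < 16W`; outside it the anchors are certified by the input) the deviation of the gauge
chart is `δ`-bounded in `C⁰`, SCALE-INVARIANTLY in `C¹`
(`r'‖D dev‖ ≤ δ`) and UNWEIGHTEDLY in `C²` — the true regularity profile of a far neck
(radiation in transit has scale-invariant `C²` size growing like `r'`, so no more is asked). -/
def Boot (𝒢 : NeckGauge S T) (δ : ℝ) : Prop :=
  ∀ i (x : E4), S.InTime T i x → 2 * S.Rg i (S.rt i x) < S.rr i x →
    S.rr i x < 16 * S.W i (S.rt i x) →
    ‖𝒢.dev i x‖ ≤ δ ∧ S.rr i x * ‖iteratedFDeriv ℝ 1 (𝒢.dev i) x‖ ≤ δ ∧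
      ‖iteratedFDeriv ℝ 2 (𝒢.dev i) x‖ ≤ δ

/-- **Transient bound with rate `ν`** on the interior neck `{4Rg ≤ r' ≤ 8W}` at lagged times:
`C⁰`, scale-invariant `C¹` and unweighted `C²` size `≤ ν(t')`, and SHELL-SQUARE-SUMMABILITY of the
scale-invariant `C¹` size through a continuous radial majorant `g` with `∫ g(s) ds/s ≤ ν(t')`
(the rectified stress of radiation in transit is what the quasi-static closure must absorb). -/
def TransientBound (𝒢 : NeckGauge S T) (ν : ℝ → ℝ) : Prop :=
  ∀ i, (∀ x : E4, S.Lagged T i x → 4 * S.Rg i (S.rt i x) ≤ S.rr i x →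
      S.rr i x ≤ 8 * S.W i (S.rt i x) →
      ‖𝒢.tr i x‖ ≤ ν (S.rt i x) ∧ S.rr i x * ‖iteratedFDeriv ℝ 1 (𝒢.tr i) x‖ ≤ ν (S.rt i x) ∧
        ‖iteratedFDeriv ℝ 2 (𝒢.tr i) x‖ ≤ ν (S.rt i x)) ∧
    ∀ τ : ℝ, S.τ₁ + 2 * S.κ i * S.W i τ ≤ τ → ((τ : ℝ) : WithTop ℝ) < T →
      S.W i τ ≤ 2 * S.W i (τ - 2 * S.κ i * S.W i τ) →
      ∃ g : ℝ → ℝ, ContinuousOn g (Set.Icc (4 * S.Rg i τ) (8 * S.W i τ)) ∧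
        (∀ s ∈ Set.Icc (4 * S.Rg i τ) (8 * S.W i τ), 0 ≤ g s) ∧
        (∫ s in (4 * S.Rg i τ)..(8 * S.W i τ), g s / s) ≤ ν τ ∧
        ∀ x : E4, S.rt i x = τ → 4 * S.Rg i τ ≤ S.rr i x → S.rr i x ≤ 8 * S.W i τ →
          (‖𝒢.tr i x‖ + S.rr i x * ‖iteratedFDeriv ℝ 1 (𝒢.tr i) x‖) ^ 2 ≤ g (S.rr i x)

/-- **Quasi-static bound with rate `μ`**: on the interior neck `{4Rg ≤ r' ≤ 8W}` at lagged times
the quasi-static part is `μ(t')`-small SCALE-INVARIANTLY in `C²`; and the transition maps are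
`μ`-close to the identity — `Ein` scale-invariantly in `C³` on `{2Rg < r' ≤ 8Rg}`, `Eout` with
`|Eout − id| ≤ μW` and UNWEIGHTED `C¹…C³` on the outer boundary layer `{8W ≤ r' < 16W}` (up to,
not across, the Dirichlet spheres). -/
def QuasiStaticBound (𝒢 : NeckGauge S T) (μ : ℝ → ℝ) : Prop :=
  ∀ i, (∀ x : E4, S.Lagged T i x → 4 * S.Rg i (S.rt i x) ≤ S.rr i x →
      S.rr i x ≤ 8 * S.W i (S.rt i x) →
      ‖𝒢.qs i x‖ + S.rr i x * ‖iteratedFDeriv ℝ 1 (𝒢.qs i) x‖ +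
        S.rr i x ^ 2 * ‖iteratedFDeriv ℝ 2 (𝒢.qs i) x‖ ≤ μ (S.rt i x)) ∧
    (∀ x : E4, S.Lagged T i x → 2 * S.Rg i (S.rt i x) < S.rr i x →
      S.rr i x ≤ 8 * S.Rg i (S.rt i x) →
      ‖𝒢.Ein i x - x‖ ≤ μ (S.rt i x) * S.Rg i (S.rt i x) ∧
        ‖iteratedFDeriv ℝ 1 (fun y ↦ 𝒢.Ein i y - y) x‖ ≤ μ (S.rt i x) ∧
        S.Rg i (S.rt i x) * ‖iteratedFDeriv ℝ 2 (fun y ↦ 𝒢.Ein i y - y) x‖ ≤ μ (S.rt i x) ∧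
        S.Rg i (S.rt i x) ^ 2 * ‖iteratedFDeriv ℝ 3 (fun y ↦ 𝒢.Ein i y - y) x‖ ≤ μ (S.rt i x)) ∧
    (∀ x : E4, S.Lagged T i x → 8 * S.W i (S.rt i x) ≤ S.rr i x →
      S.rr i x < 16 * S.W i (S.rt i x) →
      ‖𝒢.Eout i x - x‖ ≤ μ (S.rt i x) * S.W i (S.rt i x) ∧
        ‖iteratedFDeriv ℝ 1 (fun y ↦ 𝒢.Eout i y - y) x‖ ≤ μ (S.rt i x) ∧
        ‖iteratedFDeriv ℝ 2 (fun y ↦ 𝒢.Eout i y - y) x‖ ≤ μ (S.rt i x) ∧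
        ‖iteratedFDeriv ℝ 3 (fun y ↦ 𝒢.Eout i y - y) x‖ ≤ μ (S.rt i x))

/-- `Boot` is monotone in `δ`. -/
theorem Boot.mono {𝒢 : NeckGauge S T} {δ δ' : ℝ} (h : 𝒢.Boot δ) (hδ : δ ≤ δ') : 𝒢.Boot δ' := by
  intro i x ht h1 h2
  obtain ⟨a, b, c⟩ := h i x ht h1 h2
  exact ⟨a.trans hδ, b.trans hδ, c.trans hδ⟩

end NeckGauge


/-! ### The SEAM FRAME: certified final charts + seam raw material (output of the chart surgery) -/

/-- **Seam frame** for the honest `C⁴` input `d` — HYPOTHESIS STRUCTURE consumed by the seam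
surgery (`stub_seamSurgery`) and produced by the chart surgery (`stub_chartSurgery`): the FINAL
new hole charts (old chart inside `4Rg` through `reparam`, blends, gauge chart on the interior
neck, the translated flat chart outside, far leaves folded into the collar `(W+1, W+2)`), the new
tubes and flat chart, their CERTIFICATE `cert` (unweighted `C²` out to `W(τ) → ∞`), and the seam
raw material (one atlas, tube geometry, clock lag, thresholds, future-directed time-lines). This is
generation 1's `InductionZoneGauge` with its analysis section (9) REMOVED and the certificate
folded in (fields (0)–(8) verbatim, so generation 1's surgery plan applies unchanged). -/
structure SeamFrame (𝓢 : Spacetime.{0} 4) (O : Set 𝓢.carrier)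
    (d : FinalStateDecomposition 𝓢 O 4) (R₀ : ℝ) where
  /-- (0) The late time from which every clause holds. -/
  τ₁ : ℝ
  τ₀_le_τ₁ : d.τ₀ ≤ τ₁
  /-- (1) Re-labelled motions (orthochronous) and the new hole charts (late charts into `O`). -/
  motion : Fin d.N → lorentzGroup × E4
  orthochronous : ∀ i, 0 < timeAxis (motion i) 0
  chart : ∀ i, boostedKerrExterior (motion i).1 (motion i).2 (d.mass i) (d.spin i) → 𝓢.carrier
  isLateChart : ∀ i, 𝓢.IsLateChart (bg (motion i) (d.mass i) (d.spin i)) O τ₁ (chart i)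
  /-- (2) Radii: inner pin / diagonal radius `Rg → ∞` and the certified radius `W` (monotone,
  continuous), `8 Rg ≤ W`, `4M ≤ Rg` (so Kerr–Schild and Euclidean rest radii differ by
  `≤ |a| < M ≤ Rg/4` on the neck and the pinning annuli lie in the chart domain), `R₀ ≤ Rg`,
  `1 ≤ Rg`. -/
  Rg : Fin d.N → ℝ → ℝ
  W : Fin d.N → ℝ → ℝ
  monotone_W : ∀ i, Monotone (W i)
  continuous_W : ∀ i, Continuous (W i)
  continuous_Rg : ∀ i, Continuous (Rg i)
  one_le_Rg : ∀ i τ, 1 ≤ Rg i τ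
  R₀_le_Rg : ∀ i τ, R₀ ≤ Rg i τ
  four_mass_le_Rg : ∀ i τ, 4 * d.mass i ≤ Rg i τ
  tendsto_Rg : ∀ i, Tendsto (Rg i) atTop atTop
  Rg_le_W : ∀ i τ, 8 * Rg i τ ≤ W i τ
  /-- THE CERTIFICATE: unweighted `C²` deviation of the new hole chart from its boosted Kerr on
  the truncated slabs `{t' = τ, r' ≤ W(τ)}` tends to `0` (clause (2) of `Sm` with `R := W − 2`). -/
  cert : ∀ i, Tendsto (fun τ ↦ 𝓢.truncDeviationCk (bg (motion i) (d.mass i) (d.spin i)) (chart i) 2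
    (W i τ) τ) atTop (𝓝 0)
  /-- (3) Inheritance: inside `4 Rg` the new chart is the old one, reparametrised in the rest frame
  by a bijection preserving Kerr–Schild radius and re-labelling Kerr–Schild time monotonically
  (`t ↦ t + shift(t)`; generation 1 had a constant shift — a slowly varying one is needed to keep
  the two anchors synchronised). -/
  reparam : Fin d.N → E4 → E4
  shift : Fin d.N → ℝ → ℝ
  reparam_bijective : ∀ i, Function.Bijective (reparam i)
  reparam_continuous : ∀ i, Continuous (reparam i)
  strictMono_shift : ∀ i, StrictMono (fun t ↦ t + shift i t)
  continuous_shift : ∀ i, Continuous (shift i)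
  reparam_time : ∀ i z, reparam i z 0 = z 0 + shift i (z 0)
  τ₀_le_shift : ∀ i t, τ₁ ≤ t → d.τ₀ ≤ t + shift i t
  reparam_radius : ∀ i z, Kerr.radius (d.spin i) (reparam i z) = Kerr.radius (d.spin i) z
  inner_eq : ∀ i (y : E4) (hy : y ∈ boostedKerrExterior (motion i).1 (motion i).2 (d.mass i) (d.spin i)),
    τ₁ ≤ restTime (motion i) y → restRadius (motion i) (d.spin i) y ≤ 4 * Rg i (restTime (motion i) y) →
    ∃ hy' : liftToOld (motion i) (d.motion i) (reparam i) y ∈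
        boostedKerrExterior (d.motion i).1 (d.motion i).2 (d.mass i) (d.spin i),
      chart i ⟨y, hy⟩ = d.chart i ⟨liftToOld (motion i) (d.motion i) (reparam i) y, hy'⟩
  /-- (4) The new flat tubes (excision radii: continuous, sublinear in flat time, `≥ R₀`). -/
  excision : Fin d.N → ℝ → ℝ
  continuous_excision : ∀ i, Continuous (excision i)
  tendsto_excision_div : ∀ i, Tendsto (fun t ↦ excision i t / t) atTop (𝓝 0)
  R₀_le_excision : ∀ i t, R₀ ≤ excision i t
  /-- (5) The new flat chart: a late chart into `O` on an open domain containing the late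
  complement of the new tubes and consisting of tube-complement points only (`Sm` (7)),
  `C²`-certified, `C⁰`-threshold `1/10`, future-oriented; FAR from every hole (`r'_j ≥ 6 W_j`) it is
  the old flat chart re-centred by the common translation drift, `d.flatChart (y + recentre y⁰)`
  (near the tubes it may be re-gauged); every late point of the OLD flat chart is new-charted. -/
  flatDomain : Opens E4
  flatChart : flatDomain → 𝓢.carrier
  isLateChart_flat : 𝓢.IsLateChart (Minkowski.backgroundOn flatDomain) O τ₁ flatChart
  setOf_lt_excision_subset : {x : E4 | τ₁ < x 0 ∧ ∀ i, excision i (x 0) < restRadius (motion i) (d.spin i) x}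
    ⊆ (flatDomain : Set E4)
  flat_tube_complement : ∀ y : flatDomain, τ₁ ≤ y.1 0 →
    ∀ j, excision j (y.1 0) < restRadius (motion j) (d.spin j) y.1
  tendsto_deviationCk_flat :
    Tendsto (fun τ ↦ 𝓢.deviationCk (Minkowski.backgroundOn flatDomain) flatChart 2 τ) atTop (𝓝 0)
  flat_threshold : supCkENorm (Subtype.val '' {y : flatDomain | τ₁ ≤ y.1 0}) 0
    (𝓢.deviationExtend (Minkowski.backgroundOn flatDomain) flatChart) ≤ 10⁻¹
  flat_future : ∀ y : flatDomain, τ₁ < y.1 0 →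
    𝓢.timeOrientation.IsFutureDirected (mfderiv 𝓘(ℝ, E4) (𝓡 4) flatChart y (E4.basisVector 0))
  recentre : ℝ → E4
  recentre_time : ∀ t, recentre t 0 = 0
  continuous_recentre : Continuous recentre
  flat_far_eq : ∀ y : flatDomain, τ₁ ≤ y.1 0 →
    (∀ j, 6 * W j (restTime (motion j) y.1) ≤ restRadius (motion j) (d.spin j) y.1) →
    ∃ hz : y.1 + recentre (y.1 0) ∈ d.flatDomain, flatChart y = d.flatChart ⟨y.1 + recentre (y.1 0), hz⟩
  old_flat_covered : ∃ T₀ : ℝ, ∀ z : d.flatDomain, T₀ ≤ z.1 0 →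
    d.flatChart z ∈ flatChart '' (Minkowski.backgroundOn flatDomain).lateRegion τ₁ ∪
      ⋃ j, chart j '' (bg (motion j) (d.mass j) (d.spin j)).lateRegion τ₁
  /-- (6) Coordinate geometry of tubes versus the certified radius `W`: tube points sit `≥ 4`
  inside `W`; points within `W/2` of hole `i` are in its tube; hole clocks lag the flat clock on
  `{r' ≤ W + 2}`; certified tubes `(+1)` pairwise disjoint. -/
  tube_deep : ∀ i (y : E4), τ₁ ≤ y 0 → restRadius (motion i) (d.spin i) y ≤ excision i (y 0) →
    restRadius (motion i) (d.spin i) y + 4 ≤ W i (restTime (motion i) y)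
  tube_covers : ∀ i (y : E4), τ₁ ≤ y 0 →
    2 * restRadius (motion i) (d.spin i) y < W i (restTime (motion i) y) →
    restRadius (motion i) (d.spin i) y < excision i (y 0)
  clock_lag : ∀ i (y : E4), τ₁ ≤ restTime (motion i) y →
    restRadius (motion i) (d.spin i) y ≤ W i (restTime (motion i) y) + 2 → restTime (motion i) y ≤ y 0
  tubes_disjoint : ∀ i j (y : E4), i ≠ j → (τ₁ ≤ y 0 ∨ τ₁ ≤ restTime (motion i) y) →
    restRadius (motion i) (d.spin i) y ≤ W i (restTime (motion i) y) + 1 →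
    W j (restTime (motion j) y) + 1 < restRadius (motion j) (d.spin j) y
  /-- (7) One atlas: outside the new tubes and within `6W` of hole `i` the new hole chart IS the
  re-centred flat chart; far leaves (`r' > W + 1`) are flat-charted points of the same rest time in
  the collar `W + 1 < r' < W + 2` outside all tubes. -/
  one_atlas : ∀ i (y : E4) (hy : y ∈ boostedKerrExterior (motion i).1 (motion i).2 (d.mass i) (d.spin i)),
    τ₁ ≤ y 0 → (∀ j, excision j (y 0) < restRadius (motion j) (d.spin j) y) →
    restRadius (motion i) (d.spin i) y ≤ 6 * W i (restTime (motion i) y) →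
    ∃ hy' : y ∈ flatDomain, chart i ⟨y, hy⟩ = flatChart ⟨y, hy'⟩
  far_eq : ∀ i (y : E4) (hy : y ∈ boostedKerrExterior (motion i).1 (motion i).2 (d.mass i) (d.spin i)),
    τ₁ ≤ restTime (motion i) y → W i (restTime (motion i) y) + 1 < restRadius (motion i) (d.spin i) y →
    ∃ (z : E4) (hz : z ∈ flatDomain), chart i ⟨y, hy⟩ = flatChart ⟨z, hz⟩ ∧
      restTime (motion i) z = restTime (motion i) y ∧
      W i (restTime (motion i) y) + 1 < restRadius (motion i) (d.spin i) z ∧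
      restRadius (motion i) (d.spin i) z < W i (restTime (motion i) y) + 2 ∧
      ∀ j, excision j (z 0) < restRadius (motion j) (d.spin j) z
  /-- (8) `C⁰` threshold on the certified tubes `{R₀ ≤ r' ≤ W}` (shape of `Sm` (4)) and
  future-directed rest-frame time-lines on `{R₀ ≤ r'}` (shape of `Sm` (5), all radii: the far
  leaves are folded slowly). -/
  hole_threshold : ∀ i, supCkENorm (Subtype.val ''
      {x : (bg (motion i) (d.mass i) (d.spin i)).domain |
        (τ₁ ≤ restTime (motion i) x.1 ∨ τ₁ ≤ x.1 0) ∧ R₀ ≤ restRadius (motion i) (d.spin i) x.1 ∧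
          restRadius (motion i) (d.spin i) x.1 ≤ W i (restTime (motion i) x.1)}) 0
      (𝓢.deviationExtend (bg (motion i) (d.mass i) (d.spin i)) (chart i)) ≤
    ENNReal.ofReal (1 / (10 * ‖(((motion i).1 : E4 ≃L[ℝ] E4) : E4 →L[ℝ] E4)‖ ^ 2))
  hole_future : ∀ i (x : (bg (motion i) (d.mass i) (d.spin i)).domain),
    (τ₁ ≤ restTime (motion i) x.1 ∨ τ₁ ≤ x.1 0) → R₀ ≤ restRadius (motion i) (d.spin i) x.1 →
    𝓢.timeOrientation.IsFutureDirected
      (mfderiv 𝓘(ℝ, E4) (𝓡 4) (chart i) x (timeAxis (motion i)))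

/-! ### The stub statements (precise `Prop`s; the registered stubs below restate them verbatim) -/

/-- **S1 · ANNULUS PINNING (the lever; pure elliptic analysis on `E3`).** For each target
dimension `n` a constant `C` such that: for a `C²` map `u` from a neighbourhood of the annulus `{a ≤ ‖x‖ ≤ b}` (`0 < a`,
`4a ≤ b`) into a Euclidean space, and continuous-`C¹` symmetric coefficients `A` uniformly
`1/10`-close to the Euclidean inner product with scale-invariant Lipschitz bound `‖x‖‖DA‖ ≤ 1`,
the QUASILINEAR–SEMILINEAR DIFFERENTIAL INEQUALITY
`‖Aʲᵏ ∂ⱼ∂ₖ u‖ ≤ Λ₁‖Du‖² + (10⁻²/‖x‖)‖Du‖ + (10⁻³/‖x‖²)‖u‖ + g(‖x‖)` on the annulus, with the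
Hildebrandt–Widman smallness `‖u‖ ≤ δ₀`, `Λ₁δ₀ ≤ 1/10`, two-ended Dirichlet smallness `‖u‖ ≤ ε`
on both boundary spheres and a SHELL-SUMMABLE forcing majorant `∫ₐᵇ s g(s) ds ≤ M`
(`s² g(s) ≤ P`), imply `‖u‖ ≤ C(ε + M)` on the whole annulus and the scale-invariant interior
gradient bound `‖x‖‖Du(x)‖ ≤ C(ε + M + P)` on `{2a ≤ ‖x‖ ≤ b/2}`. (`‖u‖²` is a subsolution up to
`2‖u‖g`; Pucci radial barriers `r^{-β}`, `β ≈ 0.32`, are strict supersolutions for ellipticity in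
`[0.9, 1.1]` and absorb the `r⁻²` potential below the Hardy constant; `X² ≤ C(ε² + XM)` gives the
linear bound; interior `W^{2,p}`/`C^{1,α}` estimates at scale `‖x‖` with small oscillation.) -/
def AnnulusPinning : Prop :=
  ∀ n : ℕ, ∃ C : ℝ, 0 < C ∧ ∀ (U : Set E3) (u : E3 → EuclideanSpace ℝ (Fin n))
    (A : E3 → E3 →L[ℝ] E3 →L[ℝ] ℝ) (g : ℝ → ℝ) (a b ε M P Λ₁ δ₀ : ℝ),
    IsOpen U → {x : E3 | a ≤ ‖x‖ ∧ ‖x‖ ≤ b} ⊆ U → ContDiffOn ℝ 2 u U → ContDiffOn ℝ 1 A U →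
    0 < a → 4 * a ≤ b → 0 ≤ ε → 0 ≤ M → 0 ≤ P → 0 ≤ Λ₁ → 0 ≤ δ₀ → Λ₁ * δ₀ ≤ 1 / 10 →
    (∀ x : E3, a ≤ ‖x‖ → ‖x‖ ≤ b → ∀ v w : E3,
      A x v w = A x w v ∧ |A x v w - inner ℝ v w| ≤ 1 / 10 * ‖v‖ * ‖w‖) →
    (∀ x : E3, a ≤ ‖x‖ → ‖x‖ ≤ b → ∀ v w z : E3, ‖x‖ * |fderiv ℝ A x v w z| ≤ ‖v‖ * ‖w‖ * ‖z‖) →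
    (∀ x : E3, a ≤ ‖x‖ → ‖x‖ ≤ b → ‖u x‖ ≤ δ₀) →
    (∀ x : E3, ‖x‖ = a ∨ ‖x‖ = b → ‖u x‖ ≤ ε) →
    ContinuousOn g (Set.Icc a b) → (∀ s ∈ Set.Icc a b, 0 ≤ g s ∧ s ^ 2 * g s ≤ P) →
    (∫ s in a..b, s * g s) ≤ M →
    (∀ x : E3, a ≤ ‖x‖ → ‖x‖ ≤ b →
      ‖∑ j : Fin 3, ∑ k : Fin 3, A x (EuclideanSpace.single j 1) (EuclideanSpace.single k 1) •
          iteratedFDeriv ℝ 2 u x ![EuclideanSpace.single j 1, EuclideanSpace.single k 1]‖ ≤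
        Λ₁ * ‖fderiv ℝ u x‖ ^ 2 + 1 / 100 / ‖x‖ * ‖fderiv ℝ u x‖ + 1 / 1000 / ‖x‖ ^ 2 * ‖u x‖ +
          g ‖x‖) →
    (∀ x : E3, a ≤ ‖x‖ → ‖x‖ ≤ b → ‖u x‖ ≤ C * (ε + M)) ∧
    (∀ x : E3, 2 * a ≤ ‖x‖ → 2 * ‖x‖ ≤ b → ‖x‖ * ‖fderiv ℝ u x‖ ≤ C * (ε + M + P))

/-- **S3 · TRANSIENT DECAY (the radiative budget; conditional a-priori estimate).** For some
universal bootstrap size `δ₀ > 0`: for every honest input and every neck shape `S` there is a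
rate `ν → 0` (depending on the input and the shape only — NOT on the horizon `T` nor on the
gauge, which is slice-wise elliptically determined by `S`) such that every neck gauge over `S` on
any horizon `T` satisfying `Boot δ₀` has its TRANSIENT part `ν`-small on the interior neck at
lagged times: `C⁰`, scale-invariant `C¹`, unweighted `C²`, and shell-square-summable. (Outgoing
content is slaved to the fixed-radius certificate at emission — its scale-invariant `C¹` size is
`R₀ ×` the unweighted `C¹` size at `r = R₀` — with energy starvation for the square sum; the
incoming content is the route's incoming budget: `o₂` data at `t = 0` outside the cone, other
holes' late emission small by their certificates and `necks_far`. The barrier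
`WaveCoordinatesNullConditionFailure` bites HERE and only here.) -/
def TransientDecay : Prop :=
  ∃ δ₀ : ℝ, 0 < δ₀ ∧ ∀ (X : Type) [TopologicalSpace X] [ChartedSpace E3 X] [IsManifold (𝓡 3) ∞ X] [ConnectedSpace X]
    (D : InitialDataSet (𝓡 3) X), D ∈ admissibleVacuumData X →
    ∀ 𝒟 : VacuumCauchyDevelopment D, 𝒟.IsMaximal →
    ∀ (O : Set 𝒟.carrier) (d : FinalStateDecomposition 𝒟.toSpacetime O 4) (R₀ : ℝ),
      O = exteriorOf 𝒟.toCauchyDevelopment d.charted →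
      InCore 𝒟.toSpacetime O 4 d R₀ → InFar 𝒟.toSpacetime O 4 d R₀ →
      ∀ S : NeckShape 𝒟.toSpacetime O d R₀, ∃ ν : ℝ → ℝ, Tendsto ν atTop (𝓝 0) ∧
        ∀ (T : WithTop ℝ) (𝒢 : NeckGauge S T), 𝒢.Boot δ₀ → 𝒢.TransientBound ν

/-- **S4 · QUASI-STATIC DECAY (the lever applied; conditional a-priori estimate).** For some
universal `δ₀ > 0`: for every honest input, shape `S` and transient rate `ν → 0` there is a rate
`μ → 0` (input/shape/`ν` only) such that every neck gauge over `S` on any horizon with `Boot δ₀`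
and `TransientBound ν` satisfies `QuasiStaticBound μ`: in the slice-harmonic rest gauge the
vacuum equations (`ricciFlat`) are a QUASI-STATIC ELLIPTIC system for lapse, shift, slice metric
and the transition maps `Ein`, `Eout` (maximal slicing: `Δ N = N|K|²`; harmonic spatial
coordinates: `Δ βⁱ + Rⁱⱼβʲ = 2Kⁱʲ∂ⱼN`, `γᵏˡ∂ₖ∂ₗγᵢⱼ = −2N⁻¹∂ₜKᵢⱼ − 2N⁻¹∇ᵢ∇ⱼN + Q(∂γ, K, β)`),
whose past-window time average is pinned at ORDER ZERO from both ends — inside by the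
scale-invariant inherited certificate `in_cert` through `chart_in`/`Ein_eq`, outside by the old
flat chart's unweighted certificate through `chart_out`/`Eout_eq` — with shell-summable forcing
(rectified transient stress from `TransientBound`, `∂ₜ²` remainders `≲ κ⁻²(r/W)² × Boot`
absorbed below the Dirichlet eigenfrequency, Kerr–Schild tail `O(M/r³)`), so `AnnulusPinning`
and interior Schauder at scale `r'` give the scale-invariant `C²` smallness; the transition maps
obey the same two-point structure (no `O(1)` twist: alignment is in `S.motion`). -/
def QuasiStaticDecay : Prop :=
  ∃ δ₀ : ℝ, 0 < δ₀ ∧ ∀ (X : Type) [TopologicalSpace X] [ChartedSpace E3 X] [IsManifold (𝓡 3) ∞ X] [ConnectedSpace X]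
    (D : InitialDataSet (𝓡 3) X), D ∈ admissibleVacuumData X →
    ∀ 𝒟 : VacuumCauchyDevelopment D, 𝒟.IsMaximal →
    ∀ (O : Set 𝒟.carrier) (d : FinalStateDecomposition 𝒟.toSpacetime O 4) (R₀ : ℝ),
      O = exteriorOf 𝒟.toCauchyDevelopment d.charted →
      InCore 𝒟.toSpacetime O 4 d R₀ → InFar 𝒟.toSpacetime O 4 d R₀ →
      ∀ (S : NeckShape 𝒟.toSpacetime O d R₀) (ν : ℝ → ℝ), Tendsto ν atTop (𝓝 0) →
        ∃ μ : ℝ → ℝ, Tendsto μ atTop (𝓝 0) ∧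
          ∀ (T : WithTop ℝ) (𝒢 : NeckGauge S T), 𝒢.Boot δ₀ → 𝒢.TransientBound ν →
            𝒢.QuasiStaticBound μ

/-- **S2 · GAUGE CONSTRUCTION (existence of the bootstrap object, for every bootstrap size).**
Given the two conditional a-priori estimates, every honest input admits, for every `δ₀ > 0`, a
neck shape and a GLOBAL neck gauge (`T = ⊤`) satisfying `Boot δ₀`: choose the new motions
(velocity = the hole's flat-chart velocity, rotation = axis alignment at the outer anchor; needs
pairwise distinct velocities for `necks_far`), slow smooth radii by the diagonal argument, drifts
and the inner re-parametrisation; on each rest slice solve Bartnik's Plateau problem for the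
MAXIMAL slice spanning the two anchor spheres `{r' = 2Rg}` (old chart) and `{r' = 16W}` (flat
chart) and the linear Dirichlet problems for HARMONIC spatial coordinates; continuity argument in
the horizon `T` (the estimates are `T`-uniform and the gauge is slice-wise elliptic, so no
accumulation and no limit is needed), improving `Boot δ₀` to `Boot (δ₀/2)` through the two
estimates; `ricciFlat` from `𝒟.isRicciFlat` by `ChartMetricCoord.ricci_eq_ricAt` and naturality. -/
def GaugeConstruction : Prop :=
  TransientDecay → QuasiStaticDecay → ∀ (X : Type) [TopologicalSpace X] [ChartedSpace E3 X] [IsManifold (𝓡 3) ∞ X] [ConnectedSpace X]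
    (D : InitialDataSet (𝓡 3) X), D ∈ admissibleVacuumData X →
    ∀ 𝒟 : VacuumCauchyDevelopment D, 𝒟.IsMaximal →
    ∀ (O : Set 𝒟.carrier) (d : FinalStateDecomposition 𝒟.toSpacetime O 4) (R₀ : ℝ),
      O = exteriorOf 𝒟.toCauchyDevelopment d.charted →
      InCore 𝒟.toSpacetime O 4 d R₀ → InFar 𝒟.toSpacetime O 4 d R₀ →
      ∀ δ₀ : ℝ, 0 < δ₀ →
        ∃ (S : NeckShape 𝒟.toSpacetime O d R₀) (𝒢 : NeckGauge S ⊤), 𝒢.Boot δ₀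

/-- **S5 · CHART SURGERY (order split + blending: certified final charts).** From a global neck
gauge with transient and quasi-static rates `→ 0`, build a `SeamFrame`: the new hole chart is
`inChart` on `{r' ≤ 2Rg}`, the blend `inChart ∘ (id + χ(Ein − id))` on `[2Rg, 4Rg]`, the gauge
chart on `[4Rg, 8W]`, the blend `flat ∘ (+Drift) ∘ (id + χ(Eout − id))` on `[8W, 12W]` and the
drifted flat chart beyond (far leaves folded slowly into the collar); the new flat chart is the
hole chart near each hole and the old flat chart translated by the blended drift field `Drift`
(`= driftᵢ` within `64Wᵢ`, `0` beyond `128Wᵢ`) elsewhere; tubes at `W/2`. CERTIFICATE (`cert`,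
out to `W`): `dev = qs + tr` on the interior neck (both unweightedly `C²`-small since `r' ≥ 1`),
`in_cert` + `Ein`-bounds on the inner collar, `Eout`-bounds + the old flat certificate + the
Kerr–Schild tail `O(M/r')` on the outer layer, drift derivatives `→ 0`; thresholds, clock lag,
one atlas, `old_flat_covered`, future-directed time-lines are then coordinate facts. -/
def ChartSurgery : Prop :=
  ∀ (X : Type) [TopologicalSpace X] [ChartedSpace E3 X] [IsManifold (𝓡 3) ∞ X] [ConnectedSpace X]
    (D : InitialDataSet (𝓡 3) X), D ∈ admissibleVacuumData X →
    ∀ 𝒟 : VacuumCauchyDevelopment D, 𝒟.IsMaximal →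
    ∀ (O : Set 𝒟.carrier) (d : FinalStateDecomposition 𝒟.toSpacetime O 4) (R₀ : ℝ),
      O = exteriorOf 𝒟.toCauchyDevelopment d.charted →
      InCore 𝒟.toSpacetime O 4 d R₀ → InFar 𝒟.toSpacetime O 4 d R₀ →
      ∀ (S : NeckShape 𝒟.toSpacetime O d R₀) (𝒢 : NeckGauge S ⊤) (ν μ : ℝ → ℝ),
        Tendsto ν atTop (𝓝 0) → Tendsto μ atTop (𝓝 0) → 𝒢.TransientBound ν → 𝒢.QuasiStaticBound μ →
        Nonempty (SeamFrame 𝒟.toSpacetime O d R₀)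

/-- **S6 · SEAM SURGERY (Lorentzian/causal bookkeeping; shared with the route's own line).** From
an honest input and a seam frame for it, the `C²` decomposition `d₂` (charts, motions, tubes, flat
chart of the frame; `τ₀` late; `Rᵢ := Wᵢ − 2`, `R₀' := R₀`) with `O = exteriorOf d₂.charted`, `Hc`
and the twelve `Sm` clauses: anchoring and relative closedness transferred through
`inner_eq`/`reparam`, flat clauses through `flat_far_eq`/`old_flat_covered`/`flat_tube_complement`,
the covering clause and `O = exteriorOf d₂.charted` by the old anchoring to inner slabs of radius
`≤ 4Rg(τ₂)`, `Rg → ∞` (generation 1's plan, field by field). -/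
def SeamSurgery : Prop :=
  ∀ (X : Type) [TopologicalSpace X] [ChartedSpace E3 X] [IsManifold (𝓡 3) ∞ X] [ConnectedSpace X]
    (D : InitialDataSet (𝓡 3) X), D ∈ admissibleVacuumData X →
    ∀ 𝒟 : VacuumCauchyDevelopment D, 𝒟.IsMaximal →
    ∀ (O : Set 𝒟.carrier) (d : FinalStateDecomposition 𝒟.toSpacetime O 4) (R₀ : ℝ),
      O = exteriorOf 𝒟.toCauchyDevelopment d.charted →
      InCore 𝒟.toSpacetime O 4 d R₀ → InFar 𝒟.toSpacetime O 4 d R₀ →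
      ∀ F : SeamFrame 𝒟.toSpacetime O d R₀,
        ∃ (d₂ : FinalStateDecomposition 𝒟.toSpacetime O 2) (R : Fin d₂.N → ℝ → ℝ) (R₀' : ℝ),
          O = exteriorOf 𝒟.toCauchyDevelopment d₂.charted ∧ InCore 𝒟.toSpacetime O 2 d₂ R₀' ∧
            Seamed 𝒟.toSpacetime O d₂ R R₀'

/-! ### Registered stubs (`theorem stub_… : <verbatim statement> := by sorry`) -/

/-- Registered stub S1 (the lever). -/
theorem stub_annulusPinning :
    ∀ n : ℕ, ∃ C : ℝ, 0 < C ∧ ∀ (U : Set E3) (u : E3 → EuclideanSpace ℝ (Fin n))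
      (A : E3 → E3 →L[ℝ] E3 →L[ℝ] ℝ) (g : ℝ → ℝ) (a b ε M P Λ₁ δ₀ : ℝ),
      IsOpen U → {x : E3 | a ≤ ‖x‖ ∧ ‖x‖ ≤ b} ⊆ U → ContDiffOn ℝ 2 u U → ContDiffOn ℝ 1 A U →
      0 < a → 4 * a ≤ b → 0 ≤ ε → 0 ≤ M → 0 ≤ P → 0 ≤ Λ₁ → 0 ≤ δ₀ → Λ₁ * δ₀ ≤ 1 / 10 →
      (∀ x : E3, a ≤ ‖x‖ → ‖x‖ ≤ b → ∀ v w : E3,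
        A x v w = A x w v ∧ |A x v w - inner ℝ v w| ≤ 1 / 10 * ‖v‖ * ‖w‖) →
      (∀ x : E3, a ≤ ‖x‖ → ‖x‖ ≤ b → ∀ v w z : E3, ‖x‖ * |fderiv ℝ A x v w z| ≤ ‖v‖ * ‖w‖ * ‖z‖) →
      (∀ x : E3, a ≤ ‖x‖ → ‖x‖ ≤ b → ‖u x‖ ≤ δ₀) →
      (∀ x : E3, ‖x‖ = a ∨ ‖x‖ = b → ‖u x‖ ≤ ε) →
      ContinuousOn g (Set.Icc a b) → (∀ s ∈ Set.Icc a b, 0 ≤ g s ∧ s ^ 2 * g s ≤ P) →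
      (∫ s in a..b, s * g s) ≤ M →
      (∀ x : E3, a ≤ ‖x‖ → ‖x‖ ≤ b →
        ‖∑ j : Fin 3, ∑ k : Fin 3, A x (EuclideanSpace.single j 1) (EuclideanSpace.single k 1) •
            iteratedFDeriv ℝ 2 u x ![EuclideanSpace.single j 1, EuclideanSpace.single k 1]‖ ≤
          Λ₁ * ‖fderiv ℝ u x‖ ^ 2 + 1 / 100 / ‖x‖ * ‖fderiv ℝ u x‖ + 1 / 1000 / ‖x‖ ^ 2 * ‖u x‖ +
            g ‖x‖) →
      (∀ x : E3, a ≤ ‖x‖ → ‖x‖ ≤ b → ‖u x‖ ≤ C * (ε + M)) ∧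
      (∀ x : E3, 2 * a ≤ ‖x‖ → 2 * ‖x‖ ≤ b → ‖x‖ * ‖fderiv ℝ u x‖ ≤ C * (ε + M + P)) := by
  sorry

/-- Registered stub S3 (hardest: the radiative budget). -/
theorem stub_transientDecay :
    ∃ δ₀ : ℝ, 0 < δ₀ ∧ ∀ (X : Type) [TopologicalSpace X] [ChartedSpace E3 X] [IsManifold (𝓡 3) ∞ X] [ConnectedSpace X]
      (D : InitialDataSet (𝓡 3) X), D ∈ admissibleVacuumData X →
      ∀ 𝒟 : VacuumCauchyDevelopment D, 𝒟.IsMaximal →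
      ∀ (O : Set 𝒟.carrier) (d : FinalStateDecomposition 𝒟.toSpacetime O 4) (R₀ : ℝ),
        O = exteriorOf 𝒟.toCauchyDevelopment d.charted →
        InCore 𝒟.toSpacetime O 4 d R₀ → InFar 𝒟.toSpacetime O 4 d R₀ →
        ∀ S : NeckShape 𝒟.toSpacetime O d R₀, ∃ ν : ℝ → ℝ, Tendsto ν atTop (𝓝 0) ∧
          ∀ (T : WithTop ℝ) (𝒢 : NeckGauge S T), 𝒢.Boot δ₀ → 𝒢.TransientBound ν := by
  sorry

/-- Registered stub S4 (the lever applied): annulus pinning ⇒ quasi-static decay. -/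
theorem stub_quasiStaticDecay : AnnulusPinning →
    ∃ δ₀ : ℝ, 0 < δ₀ ∧ ∀ (X : Type) [TopologicalSpace X] [ChartedSpace E3 X] [IsManifold (𝓡 3) ∞ X] [ConnectedSpace X]
      (D : InitialDataSet (𝓡 3) X), D ∈ admissibleVacuumData X →
      ∀ 𝒟 : VacuumCauchyDevelopment D, 𝒟.IsMaximal →
      ∀ (O : Set 𝒟.carrier) (d : FinalStateDecomposition 𝒟.toSpacetime O 4) (R₀ : ℝ),
        O = exteriorOf 𝒟.toCauchyDevelopment d.charted →
        InCore 𝒟.toSpacetime O 4 d R₀ → InFar 𝒟.toSpacetime O 4 d R₀ →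
        ∀ (S : NeckShape 𝒟.toSpacetime O d R₀) (ν : ℝ → ℝ), Tendsto ν atTop (𝓝 0) →
          ∃ μ : ℝ → ℝ, Tendsto μ atTop (𝓝 0) ∧
            ∀ (T : WithTop ℝ) (𝒢 : NeckGauge S T), 𝒢.Boot δ₀ → 𝒢.TransientBound ν →
              𝒢.QuasiStaticBound μ := by
  sorry

/-- Registered stub S2 (gauge construction by continuity). -/
theorem stub_gaugeConstruction :
    TransientDecay → QuasiStaticDecay → ∀ (X : Type) [TopologicalSpace X] [ChartedSpace E3 X] [IsManifold (𝓡 3) ∞ X] [ConnectedSpace X]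
      (D : InitialDataSet (𝓡 3) X), D ∈ admissibleVacuumData X →
      ∀ 𝒟 : VacuumCauchyDevelopment D, 𝒟.IsMaximal →
      ∀ (O : Set 𝒟.carrier) (d : FinalStateDecomposition 𝒟.toSpacetime O 4) (R₀ : ℝ),
        O = exteriorOf 𝒟.toCauchyDevelopment d.charted →
        InCore 𝒟.toSpacetime O 4 d R₀ → InFar 𝒟.toSpacetime O 4 d R₀ →
        ∀ δ₀ : ℝ, 0 < δ₀ →
          ∃ (S : NeckShape 𝒟.toSpacetime O d R₀) (𝒢 : NeckGauge S ⊤), 𝒢.Boot δ₀ := by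
  sorry

/-- Registered stub S5 (chart surgery: order split + blending). -/
theorem stub_chartSurgery :
    ∀ (X : Type) [TopologicalSpace X] [ChartedSpace E3 X] [IsManifold (𝓡 3) ∞ X] [ConnectedSpace X]
      (D : InitialDataSet (𝓡 3) X), D ∈ admissibleVacuumData X →
      ∀ 𝒟 : VacuumCauchyDevelopment D, 𝒟.IsMaximal →
      ∀ (O : Set 𝒟.carrier) (d : FinalStateDecomposition 𝒟.toSpacetime O 4) (R₀ : ℝ),
        O = exteriorOf 𝒟.toCauchyDevelopment d.charted →
        InCore 𝒟.toSpacetime O 4 d R₀ → InFar 𝒟.toSpacetime O 4 d R₀ →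
        ∀ (S : NeckShape 𝒟.toSpacetime O d R₀) (𝒢 : NeckGauge S ⊤) (ν μ : ℝ → ℝ),
          Tendsto ν atTop (𝓝 0) → Tendsto μ atTop (𝓝 0) → 𝒢.TransientBound ν → 𝒢.QuasiStaticBound μ →
          Nonempty (SeamFrame 𝒟.toSpacetime O d R₀) := by
  sorry

/-- Registered stub S6 (seam surgery). -/
theorem stub_seamSurgery :
    ∀ (X : Type) [TopologicalSpace X] [ChartedSpace E3 X] [IsManifold (𝓡 3) ∞ X] [ConnectedSpace X]
      (D : InitialDataSet (𝓡 3) X), D ∈ admissibleVacuumData X →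
      ∀ 𝒟 : VacuumCauchyDevelopment D, 𝒟.IsMaximal →
      ∀ (O : Set 𝒟.carrier) (d : FinalStateDecomposition 𝒟.toSpacetime O 4) (R₀ : ℝ),
        O = exteriorOf 𝒟.toCauchyDevelopment d.charted →
        InCore 𝒟.toSpacetime O 4 d R₀ → InFar 𝒟.toSpacetime O 4 d R₀ →
        ∀ F : SeamFrame 𝒟.toSpacetime O d R₀,
          ∃ (d₂ : FinalStateDecomposition 𝒟.toSpacetime O 2) (R : Fin d₂.N → ℝ → ℝ) (R₀' : ℝ),
            O = exteriorOf 𝒟.toCauchyDevelopment d₂.charted ∧ InCore 𝒟.toSpacetime O 2 d₂ R₀' ∧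
              Seamed 𝒟.toSpacetime O d₂ R R₀' := by
  sorry

/-- Name check: each registered stub is LITERALLY the statement above. -/
theorem annulusPinning_holds : AnnulusPinning := stub_annulusPinning
theorem transientDecay_holds : TransientDecay := stub_transientDecay
theorem quasiStaticDecay_holds : AnnulusPinning → QuasiStaticDecay := stub_quasiStaticDecay
theorem gaugeConstruction_holds : GaugeConstruction := stub_gaugeConstruction
theorem chartSurgery_holds : ChartSurgery := stub_chartSurgery
theorem seamSurgery_holds : SeamSurgery := stub_seamSurgery

/-! ### Name-keyed hypotheses for the skeleton audit -/

namespace Registered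

/-- Registered stub S1, by name. -/
abbrev stub_annulusPinning : Prop := AnnulusPinning
/-- Registered stub S3, by name. -/
abbrev stub_transientDecay : Prop := TransientDecay
/-- Registered stub S4, by name. -/
abbrev stub_quasiStaticDecay : Prop := AnnulusPinning → QuasiStaticDecay
/-- Registered stub S2, by name. -/
abbrev stub_gaugeConstruction : Prop := GaugeConstruction
/-- Registered stub S5, by name. -/
abbrev stub_chartSurgery : Prop := ChartSurgery
/-- Registered stub S6, by name. -/
abbrev stub_seamSurgery : Prop := SeamSurgery

end Registered

/-! ### The composition: the crux from the six stubs -/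

/-- **`NecksCertify` from the six stubs** (kernel-checked, no `sorry` here): unfold the crux; take
the bootstrap sizes `δ₁` (transient) and `δ₂` (quasi-static, fed with the pinning lemma); build
the global gauge with `Boot (min δ₁ δ₂)`; read off the transient rate `ν`, then the quasi-static
rate `μ`; perform the chart surgery; hand the seam frame to the seam surgery. -/
theorem NecksCertify_of (hPin : Registered.stub_annulusPinning)
    (hTr : Registered.stub_transientDecay) (hQs : Registered.stub_quasiStaticDecay)
    (hGauge : Registered.stub_gaugeConstruction) (hSurg : Registered.stub_chartSurgery)
    (hSeam : Registered.stub_seamSurgery) :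
    _root_.Summit.FinalStateConjecture.FinalStateConjecture.Theses.StarvedNecks.NecksCertify := by
  rw [necksCertify_iff]
  intro X _ _ _ _ D hD 𝒟 h𝒟 O d R₀ hO hc hf
  obtain ⟨δ₁, hδ₁, H₁⟩ := id hTr
  obtain ⟨δ₂, hδ₂, H₂⟩ := hQs hPin
  obtain ⟨S, 𝒢, hB⟩ :=
    hGauge hTr (hQs hPin) X D hD 𝒟 h𝒟 O d R₀ hO hc hf (min δ₁ δ₂) (lt_min hδ₁ hδ₂)
  obtain ⟨ν, hν, Hν⟩ := H₁ X D hD 𝒟 h𝒟 O d R₀ hO hc hf S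
  have hT : 𝒢.TransientBound ν := Hν ⊤ 𝒢 (hB.mono (min_le_left _ _))
  obtain ⟨μ, hμ, Hμ⟩ := H₂ X D hD 𝒟 h𝒟 O d R₀ hO hc hf S ν hν
  have hQ : 𝒢.QuasiStaticBound μ := Hμ ⊤ 𝒢 (hB.mono (min_le_right _ _)) hT
  obtain ⟨F⟩ := hSurg X D hD 𝒟 h𝒟 O d R₀ hO hc hf S 𝒢 ν μ hν hμ hT hQ
  exact hSeam X D hD 𝒟 h𝒟 O d R₀ hO hc hf F

/-- Wiring check (an `example`, so that `NecksCertify_of` stays the unique theorem of this file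
concluding the crux): the registered stubs feed the composition as stated. -/
example : _root_.Summit.FinalStateConjecture.FinalStateConjecture.Theses.StarvedNecks.NecksCertify :=
  NecksCertify_of stub_annulusPinning stub_transientDecay stub_quasiStaticDecay
    stub_gaugeConstruction stub_chartSurgery stub_seamSurgery

end Summit.FinalStateConjecture.FinalStateConjecture.Cruxes.NecksCertify.OrderZeroInductionZone

end
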